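import Literature.NumberTheory.EllipticCurves.KugaSatoVariety
import Literature.AlgebraicGeometry.Motives.VarietiesGeometricallyIntegralProofs
import Literature.AlgebraicGeometry.Motives.VarietiesProperProofs
import HarnessLib

/-!
# Relations among the automorphisms of a Kuga–Sato variety

Topic: `Literature/NumberTheory/EllipticCurves`. A `KugaSatoVariety K m N`
(`KugaSatoVariety.lean`) carries automorphisms `translW i (a, b)`, `negW i`, `permW σ` of `W`
extending the translations by `N`-torsion sections, the inversions and the permutations of the
factors of the dense open `E^m ↪ W` (Deninger–Scholl 5.3 (i): these "generate a group `Γ` of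
automorphisms of `X_n^k`, and this extends to a group of automorphisms" of the desingularisation;
Scholl's projector is `Π = |Γ|⁻¹ ∑ ε(γ) γ`). The structure records only that each extension
EXISTS; as its design notes say, "since `E^m ↪ W` is a dense open immersion into a separated
reduced scheme, the extensions are unique, so all relations among these automorphisms are those
of their restrictions to `E^m`". This file proves that sentence and the resulting relations:

* on `E^m` (any `S`-scheme / `S`-group scheme `E`): `KugaSato.onFactor_comp`, `onFactor_perm`
  (`onFactor i f ≫ perm σ = perm σ ≫ onFactor (σ i) f`), `onFactor_onFactor_of_ne`,
  `neg_comp_neg`, `transl_comp_transl`, `transl_perm`, `neg_perm`, and for a level structure with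
  commuting `P, Q`: `LevelStructure.section_add`;
* on `W`: `KugaSatoVariety.hom_ext` — two `K`-morphisms out of `W` into a separated `K`-scheme
  that agree on `E^m` are equal (`W` is integral, hence reduced, by
  `IsSmoothProjective.isIntegral_holds`; `E^m ↪ W` is dominant; Mathlib
  `ext_of_isDominant_of_isSeparated`), `iso_eq_of_extends`;
* the relations: `permW_one`, `permW_mul` (a right action of `S_m`), `negW_trans_negW`
  (involutions), `negW_permW`, `translW_permW` (`S_m` permutes the factors of `μ₂^m` and
  `(ℤ/N)^{2m}`), `translW_translW` (additivity in `(ℤ/N)²`, for commuting `P, Q`), and the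
  commutation of generators living on different factors (`translW_comm_of_ne`, `negW_comm_of_ne`,
  `translW_negW_of_ne`).

No named facts; the two discharged facts `IsSmoothProjective.isIntegral_holds`,
`IsSmoothProjective.isProper_holds` of `Literature/AlgebraicGeometry/Motives` are used as theorems.

## References

* C. Deninger, A. J. Scholl, *The Beilinson conjectures* (1991), 5.3 (i). [DeningerScholl1991]
* A. J. Scholl, *Motives for modular forms*, Invent. Math. 100 (1990), §1. [Scholl1990]
-/

universe u

open CategoryTheory Limits AlgebraicGeometry MonoidalCategory CartesianMonoidalCategory
open scoped MonObj

noncomputable section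

namespace Literature.NumberTheory.EllipticCurves

/-! ### Relations on the fibre power `E^m` -/

namespace KugaSato

variable {S : Scheme.{u}} (E : Over S) (m : ℕ)

/-- `onFactor i` is multiplicative in the endomorphism. [folklore] -/
theorem onFactor_comp (i : Fin m) (f g : E ⟶ E) :
    onFactor E m i f ≫ onFactor E m i g = onFactor E m i (f ≫ g) :=
  hom_ext E m fun j => by
    by_cases h : j = i
    · subst h
      rw [Category.assoc, onFactor_proj_self, ← Category.assoc, onFactor_proj_self, Category.assoc,
        onFactor_proj_self]
    · rw [Category.assoc, onFactor_proj_of_ne E m h, onFactor_proj_of_ne E m h,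
        onFactor_proj_of_ne E m h]

/-- Permutations conjugate `onFactor i f` into `onFactor (σ i) f`. [folklore] -/
theorem onFactor_perm (i : Fin m) (f : E ⟶ E) (σ : Equiv.Perm (Fin m)) :
    onFactor E m i f ≫ perm E m σ = perm E m σ ≫ onFactor E m (σ i) f :=
  hom_ext E m fun j => by
    rw [Category.assoc, perm_proj, Category.assoc]
    by_cases h : j = σ i
    · subst h
      rw [onFactor_proj_self, ← Category.assoc, perm_proj, Equiv.symm_apply_apply,
        onFactor_proj_self]
    · have h' : σ.symm j ≠ i := fun h' => h (by rw [← h', Equiv.apply_symm_apply])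
      rw [onFactor_proj_of_ne E m h', onFactor_proj_of_ne E m h, perm_proj]

/-- Endomorphisms acting on different factors commute. [folklore] -/
theorem onFactor_onFactor_of_ne {i j : Fin m} (h : i ≠ j) (f g : E ⟶ E) :
    onFactor E m i f ≫ onFactor E m j g = onFactor E m j g ≫ onFactor E m i f :=
  hom_ext E m fun k => by
    by_cases hi : k = i
    · subst hi
      rw [Category.assoc, onFactor_proj_of_ne E m h, onFactor_proj_self, Category.assoc,
        onFactor_proj_self, ← Category.assoc, onFactor_proj_of_ne E m h]
    · by_cases hj : k = j
      · subst hj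
        rw [Category.assoc, onFactor_proj_self, ← Category.assoc, onFactor_proj_of_ne E m hi,
          Category.assoc, onFactor_proj_of_ne E m hi, onFactor_proj_self]
      · rw [Category.assoc, onFactor_proj_of_ne E m hj, onFactor_proj_of_ne E m hi,
          Category.assoc, onFactor_proj_of_ne E m hi, onFactor_proj_of_ne E m hj]

variable [GrpObj E]

/-- The inversion in a factor is an involution: `neg i ≫ neg i = 𝟙`. [folklore] -/
theorem neg_comp_neg (i : Fin m) : neg E m i ≫ neg E m i = 𝟙 _ := by
  rw [neg, onFactor_comp, GrpObj.inv_comp_inv, onFactor_id]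

/-- Translations in a factor compose: `transl i s ≫ transl i t = transl i (s · t)`
(right translations, `x ↦ x s ↦ x s t`). [folklore] -/
theorem transl_comp_transl (i : Fin m) (s t : 𝟙_ (Over S) ⟶ E) :
    transl E m i s ≫ transl E m i t = transl E m i (s * t) := by
  rw [transl, transl, transl, onFactor_comp]
  congr 1
  rw [MonObj.comp_mul, Category.comp_id, comp_toUnit_assoc, MonObj.comp_mul, mul_assoc]

/-- Permutations conjugate the translation in factor `i` into the translation in factor `σ i`.
[folklore] -/
theorem transl_perm (i : Fin m) (s : 𝟙_ (Over S) ⟶ E) (σ : Equiv.Perm (Fin m)) :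
    transl E m i s ≫ perm E m σ = perm E m σ ≫ transl E m (σ i) s :=
  onFactor_perm E m i _ σ

/-- Permutations conjugate the inversion in factor `i` into the inversion in factor `σ i`.
[folklore] -/
theorem neg_perm (i : Fin m) (σ : Equiv.Perm (Fin m)) :
    neg E m i ≫ perm E m σ = perm E m σ ≫ neg E m (σ i) :=
  onFactor_perm E m i _ σ

end KugaSato

namespace EllCurveOver.LevelStructure

variable {S : Scheme.{u}} {C : EllCurveOver S} {N : ℕ} (φ : LevelStructure N C)

/-- For commuting `P, Q`, `(a, b) ↦ φ(a, b) = P^a Q^b` is additive: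
`φ(u + v) = φ(u) φ(v)`. [folklore] -/
theorem section_add [NeZero N] (hc : Commute φ.P φ.Q) (u v : ZMod N × ZMod N) :
    φ.section_ (u + v) = φ.section_ u * φ.section_ v := by
  simp only [section_, Prod.fst_add, Prod.snd_add]
  rw [ZMod.val_add, ← pow_eq_pow_mod _ φ.pow_P, pow_add, ZMod.val_add, ← pow_eq_pow_mod _ φ.pow_Q,
    pow_add]
  exact ((hc.symm.pow_pow u.2.val v.1.val).mul_mul_mul_comm (φ.P ^ u.1.val) (φ.Q ^ v.2.val)).symm

end EllCurveOver.LevelStructure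

/-! ### Uniqueness of extensions to `W` and the relations in `Aut W` -/

namespace KugaSatoVariety

open Literature.AlgebraicGeometry.Motives

variable {K : Type u} [Field K] {m N : ℕ} (V : KugaSatoVariety K m N)

/-- `W` is an integral scheme (smooth projective geometrically irreducible over `K`;
`IsSmoothProjective.isIntegral_holds`). [folklore] -/
theorem isIntegral : IsIntegral V.W.left :=
  IsSmoothProjective.isIntegral_holds V.smoothProjective

/-- `W → Spec K` is proper (`IsSmoothProjective.isProper_holds`), in particular separated.
[folklore] -/
theorem isProper : IsProper V.W.hom :=
  IsSmoothProjective.isProper_holds V.smoothProjective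

/-- **Uniqueness of extensions from `E^m` to `W`.** Two `K`-morphisms from `W` to a `K`-scheme
`T` separated over `K` which agree on the dense open `E^m ↪ W` are equal: `W` is reduced (indeed
integral) and `E^m → W` is dominant (Mathlib `ext_of_isDominant_of_isSeparated`). This is the
sentence "the extensions, when they exist, are unique" of the design notes of `KugaSatoVariety`.
[folklore] -/
theorem hom_ext {T : SchemeOver K} [IsSeparated T.hom] {f₁ f₂ : V.W ⟶ T}
    (h : V.jW ≫ f₁.left = V.jW ≫ f₂.left) : f₁ = f₂ := by
  have hI : IsIntegral V.W.left := V.isIntegral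
  have hD : IsDominant V.jW := V.jW_isDominant
  exact Over.OverMorphism.ext
    (ext_of_isDominant_of_isSeparated T.hom (by rw [Over.w, Over.w]) V.jW h)

/-- Two `K`-endomorphisms of `W` which agree on `E^m` are equal. [folklore] -/
theorem hom_ext' {f₁ f₂ : V.W ⟶ V.W} (h : V.jW ≫ f₁.left = V.jW ≫ f₂.left) : f₁ = f₂ :=
  have : IsSeparated V.W.hom := V.isProper.toIsSeparated
  V.hom_ext h

/-- **Automorphisms of `W` are determined by what they extend.** If `e₁`, `e₂ : W ≅ W` extend
endomorphisms `a₁`, `a₂` of `E^m` and `a₁ = a₂`, then `e₁ = e₂`. [folklore] -/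
theorem iso_eq_of_extends {e₁ e₂ : V.W ≅ V.W}
    {a₁ a₂ : KugaSato.fibrePower V.curve.E m ⟶ KugaSato.fibrePower V.curve.E m}
    (h₁ : V.jW ≫ e₁.hom.left = a₁.left ≫ V.jW) (h₂ : V.jW ≫ e₂.hom.left = a₂.left ≫ V.jW)
    (ha : a₁ = a₂) : e₁ = e₂ :=
  Iso.ext (V.hom_ext' (by rw [h₁, h₂, ha]))

/-- If `e₁` extends `a₁` and `e₂` extends `a₂` then `e₁ ≪≫ e₂` extends `a₁ ≫ a₂`. [folklore] -/
theorem trans_extends {e₁ e₂ : V.W ≅ V.W}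
    {a₁ a₂ : KugaSato.fibrePower V.curve.E m ⟶ KugaSato.fibrePower V.curve.E m}
    (h₁ : V.jW ≫ e₁.hom.left = a₁.left ≫ V.jW) (h₂ : V.jW ≫ e₂.hom.left = a₂.left ≫ V.jW) :
    V.jW ≫ (e₁ ≪≫ e₂).hom.left = (a₁ ≫ a₂).left ≫ V.jW := by
  rw [Iso.trans_hom, Over.comp_left, ← Category.assoc, h₁, Category.assoc, h₂, ← Category.assoc,
    ← Over.comp_left]

/-- The identity of `W` extends the identity of `E^m`. [folklore] -/
theorem refl_extends :
    V.jW ≫ (Iso.refl V.W).hom.left =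
      Over.Hom.left (𝟙 (KugaSato.fibrePower V.curve.E m)) ≫ V.jW := by
  rw [Iso.refl_hom, Over.id_left, Over.id_left, Category.id_comp, Category.comp_id]

/-- **`permW 1 = 𝟙`.** [folklore] -/
theorem permW_one : V.permW 1 = Iso.refl V.W :=
  V.iso_eq_of_extends (V.permW_extends 1) V.refl_extends (KugaSato.perm_one V.curve.E m)

/-- **`σ ↦ permW σ` is an action of `S_m` on `W`** (a right action with this composition
convention, as `KugaSato.perm_mul`): `permW (σ τ) = permW τ ≫ permW σ`
(Deninger–Scholl 5.3 (i), the symmetric group). [cite: DeningerScholl1991, 5.3 (i)] -/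
theorem permW_mul (σ τ : Equiv.Perm (Fin m)) : V.permW (σ * τ) = V.permW τ ≪≫ V.permW σ :=
  V.iso_eq_of_extends (V.permW_extends (σ * τ))
    (V.trans_extends (V.permW_extends τ) (V.permW_extends σ)) (KugaSato.perm_mul V.curve.E m σ τ)

/-- **The inversions `negW i` are involutions** (Deninger–Scholl 5.3 (i), `μ₂^k`).
[cite: DeningerScholl1991, 5.3 (i)] -/
theorem negW_trans_negW (i : Fin m) : V.negW i ≪≫ V.negW i = Iso.refl V.W :=
  V.iso_eq_of_extends (V.trans_extends (V.negW_extends i) (V.negW_extends i)) V.refl_extends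
    (KugaSato.neg_comp_neg V.curve.E m i)

/-- **`S_m` permutes the inversions**: `negW i ≫ permW σ = permW σ ≫ negW (σ i)`.
[cite: DeningerScholl1991, 5.3 (i)] -/
theorem negW_permW (i : Fin m) (σ : Equiv.Perm (Fin m)) :
    V.negW i ≪≫ V.permW σ = V.permW σ ≪≫ V.negW (σ i) :=
  V.iso_eq_of_extends (V.trans_extends (V.negW_extends i) (V.permW_extends σ))
    (V.trans_extends (V.permW_extends σ) (V.negW_extends (σ i))) (KugaSato.neg_perm V.curve.E m i σ)

/-- **`S_m` permutes the translations**: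
`translW i (a,b) ≫ permW σ = permW σ ≫ translW (σ i) (a,b)`. [cite: DeningerScholl1991, 5.3 (i)] -/
theorem translW_permW (i : Fin m) (ab : ZMod N × ZMod N) (σ : Equiv.Perm (Fin m)) :
    V.translW i ab ≪≫ V.permW σ = V.permW σ ≪≫ V.translW (σ i) ab :=
  V.iso_eq_of_extends (V.trans_extends (V.translW_extends i ab) (V.permW_extends σ))
    (V.trans_extends (V.permW_extends σ) (V.translW_extends (σ i) ab))
    (KugaSato.transl_perm V.curve.E m i _ σ)

/-- **The translations are additive in `(a, b) ∈ (ℤ/N)²`**: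
`translW i u ≫ translW i v = translW i (u + v)`, provided the basis sections `P, Q` commute
(automatic for an elliptic curve, Katz–Mazur 2.1.2, but not recorded by `EllCurveOver`)
(Deninger–Scholl 5.3 (i), `(ℤ/n)^{2k}`). [cite: DeningerScholl1991, 5.3 (i)] -/
theorem translW_translW [NeZero N] (hc : Commute V.level.P V.level.Q) (i : Fin m)
    (u v : ZMod N × ZMod N) : V.translW i u ≪≫ V.translW i v = V.translW i (u + v) :=
  V.iso_eq_of_extends (V.trans_extends (V.translW_extends i u) (V.translW_extends i v))
    (V.translW_extends i (u + v))
    (by rw [KugaSato.transl_comp_transl, ← V.level.section_add hc])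

/-- Translations on different factors commute. [folklore] -/
theorem translW_comm_of_ne {i j : Fin m} (h : i ≠ j) (u v : ZMod N × ZMod N) :
    V.translW i u ≪≫ V.translW j v = V.translW j v ≪≫ V.translW i u :=
  V.iso_eq_of_extends (V.trans_extends (V.translW_extends i u) (V.translW_extends j v))
    (V.trans_extends (V.translW_extends j v) (V.translW_extends i u))
    (KugaSato.onFactor_onFactor_of_ne V.curve.E m h _ _)

/-- Inversions on different factors commute. [folklore] -/
theorem negW_comm_of_ne {i j : Fin m} (h : i ≠ j) :
    V.negW i ≪≫ V.negW j = V.negW j ≪≫ V.negW i :=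
  V.iso_eq_of_extends (V.trans_extends (V.negW_extends i) (V.negW_extends j))
    (V.trans_extends (V.negW_extends j) (V.negW_extends i))
    (KugaSato.onFactor_onFactor_of_ne V.curve.E m h _ _)

/-- A translation and an inversion on different factors commute. [folklore] -/
theorem translW_negW_of_ne {i j : Fin m} (h : i ≠ j) (u : ZMod N × ZMod N) :
    V.translW i u ≪≫ V.negW j = V.negW j ≪≫ V.translW i u :=
  V.iso_eq_of_extends (V.trans_extends (V.translW_extends i u) (V.negW_extends j))
    (V.trans_extends (V.negW_extends j) (V.translW_extends i u))
    (KugaSato.onFactor_onFactor_of_ne V.curve.E m h _ _)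

end KugaSatoVariety

end Literature.NumberTheory.EllipticCurves

end
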